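import Summits.HodgeConjecture.HodgeConjecture.Theorems.WeilTypeLadderQuadraticVariationalOnPath
import Summits.HodgeConjecture.HodgeConjecture.Theorems.HeckePrymWeilHyperbolicEightfoldsSqrtMinus7OfAnchorObject
import HarnessLib

/-!
# WeilTypeLadder · the transport leaf R∞var DISCHARGED at semiregular polarised anchors (Perry's engine), every `n, d`

b2b cell `hweil` (packet `run/shared/lean/b2b/hodge-weil/`; LADDER `## CARVER` C3 row P2-next (iii): "the first
ENGINE instance = the ladder's BC5-style witness: a Perry/Buchweitz–Flenner semiregularity FACT ⟹ LOCAL-R∞var …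
re-derive the floor F0a INSIDE the anc ∧ var skeleton"). Prover 2, generation 2 (variational).

The ladder's quadratic rungs are dominated by ANCHOR SUPPLY ∧ TRANSPORT (`Theorems/WeilTypeLadderQuadraticVariational
{,OnPath}.lean`: R∞anc ∧ R∞var ⟹ R∞, and R∞anc ∧ LOCAL-R∞var ⟹ R∞). The transport leaf R∞var
(`WeilVariationalHodgeQuadratic`) is an instance of Grothendieck's variational Hodge conjecture — OPEN for a
general algebraic anchor. This file proves, for every `n, d`, that its CONCLUSION holds — on the nose, for every
fibre, with no LOCAL/Baire step — along any family in R∞var's binders whose anchor class is the Weil part of the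
Chern character of a FULLY SEMIREGULAR finite locally free sheaf with polarised Chern character
(`ch_k(E₀) = q_k·H_{s₀}^k` for `k ≠ n`, `ch_n(E₀) = q_n·H_{s₀}^n + W_{s₀}`, `H` a global class with rational
`(1,1)` restrictions), GRANTED Perry's semiregularity theorem (`Perry2026_semiregularFull_remainsAlgebraic`,
arXiv:2604.00511 Thm. 1.1 (2), a named claim-fact, unrefereed) — by the route's landed general-`n` engine
`Theorems.HyperbolicEightfoldsSqrtMinus7.AnchorObject.engine_of_perry` (p-landed, crux 14642 lead c11) plus the
subtraction of the algebraic ballast `q_n·H_s^n` (Lefschetz `(1,1)` discharged + Kleiman on the abelian chart).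

So, kernel-checked: **on the semiregular-anchor sub-class, R∞var is not a conjecture but (modulo Perry) a theorem;
the ENTIRE open content of R∞ = R∞anc ∧ R∞var there is the existence of the anchor OBJECT** — exactly the
registered object stubs of the hub's Perry lines (`stub_polarisedSemiregularTowerSixAllD` of
`Cruxes/WeilSixfolds/Lines/perry_cm_tower_all_d.lean`, `S⁺_sh(7,3)` of stmt-1260's `semihomogeneous_perry_design`,
`SecantAnchorObject47` of stmt-14642), and Markman's floor F0a is the instance `n = 3` with his (twisted, reflexive)
secant sheaves — whose twist is precisely what the tree's untwisted `IsISemiregular` rendering does not yet carry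
(the honest gap between "re-derive F0a" and this file). Nothing is asserted: Perry's fact is a hypothesis.

Serves stmt-HodgeConjecture-2522 (R∞ ↔ `TropicalCuspLift.WeilClassesAlgebraic`) without closing it. Sorry-free; no definition.
-/

-- every declaration of this problem lives in `Summit.HodgeConjecture.HodgeConjecture.…` (summit = sub-problem)
set_option linter.dupNamespace false

noncomputable section

open CategoryTheory

namespace Summit.HodgeConjecture.HodgeConjecture.WeilTypeLadder

open Literature.AlgebraicGeometry Literature.AlgebraicGeometry.Motives
open Literature.AlgebraicGeometry.HodgeTheory
open Literature.AlgebraicTopology.SingularHomology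
open Summit.HodgeConjecture.HodgeConjecture.Theorems.HyperbolicEightfoldsSqrtMinus7.AnchorObject
  (engine_of_perry complexBetti_map_cupPowTwo cupPowTwo_mem_algebraicClasses_abelian)

/-- **R∞var's conclusion at a semiregular polarised anchor, every `n ≥ 1`, from Perry's theorem.** In the binders
of `WeilVariationalHodgeQuadratic` (smooth projective family `f : 𝒳 ⟶ S` of relative dimension `2n` over a smooth
irreducible quasi-projective base, global `W ∈ H^{2n}(𝒳)` with rational `(n,n)` restrictions, abelian fibre charts —
here only `A'.X ≅ 𝒳_s` for every `s` is used, not the Weil-plane clause), let `H ∈ H²(𝒳)` have rational `(1,1)`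
restrictions and let the anchor `s₀` carry a finite locally free FULLY SEMIREGULAR `E₀` on `𝒳_{s₀}` with
`ch_k(E₀) = q_k·H_{s₀}^k` (`k ≠ n`) and `ch_n(E₀) = q_n·H_{s₀}^n + W_{s₀}` in some Chern character theory `C`.
Then `W|_{𝒳_s}` is algebraic for EVERY `s` (no algebraicity hypothesis at `s₀` is needed: it is implied). Proof:
`engine_of_perry` makes `q_n·H_s^n + W_s` algebraic; `H_s^n` is algebraic on the abelian chart (Lefschetz `(1,1)`,
discharged in the tree, plus Kleiman: `cupPowTwo_mem_algebraicClasses_abelian`), transported back by the iso; subtract.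
CONDITIONAL on `Perry2026_semiregularFull_remainsAlgebraic` only. [cite: Perry2026Semiregularity, Thm. 1.1 (2)]
[cite: BuchweitzFlenner2003, Thm. 5.1] [cite: VoisinHodgeII2003, §9.2.4 Prop. 9.20] -/
theorem weilVariationalHodgeQuadratic_conclusion_of_perry_semiregularAnchor
    (hP : Perry2026_semiregularFull_remainsAlgebraic) (n : ℕ) (hn : 1 ≤ n)
    {𝒳 S : Motives.SchemeOver ℂ} (f : 𝒳 ⟶ S) (hf : Motives.IsSmoothProjectiveFamily f (2 * n))
    (hirr : IrreducibleSpace S.left) (hS : AlgebraicGeometry.Smooth S.hom) (hSqp : IsQuasiProjectiveOver S)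
    (H : complexBetti 𝒳 2)
    (hH : ∀ s, IsRationalClass (complexBetti.map (Motives.fiberι f s) 2 H) ∧
      IsOfHodgeType (2 * n) (Motives.fiberOver f s) 2 1 1 (complexBetti.map (Motives.fiberι f s) 2 H))
    (W : complexBetti 𝒳 (2 * n))
    (hW : ∀ s, IsRationalClass (complexBetti.map (Motives.fiberι f s) (2 * n) W) ∧
      IsOfHodgeType (2 * n) (Motives.fiberOver f s) (2 * n) n n (complexBetti.map (Motives.fiberι f s) (2 * n) W))
    (hchart : ∀ s, ∃ A' : Motives.AbelianVariety ℂ, A'.dim = 2 * n ∧ Nonempty (A'.X ≅ Motives.fiberOver f s))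
    (s₀ : Motives.ComplexPoints S) (C : ChernCharacterBetti) (E₀ : (Motives.fiberOver f s₀).left.Modules)
    (hE₀ : Motives.IsFiniteLocallyFree E₀) (hsr : IsISemiregular hE₀ Set.univ) (q : ℕ → ℚ)
    (hk : ∀ k : ℕ, k ≠ n →
      C.ch (Motives.fiberOver f s₀) E₀ k = ((q k : ℚ) : ℂ) • cupPowTwo (complexBetti.map (Motives.fiberι f s₀) 2 H) k)
    (hchn : C.ch (Motives.fiberOver f s₀) E₀ n =
      ((q n : ℚ) : ℂ) • cupPowTwo (complexBetti.map (Motives.fiberι f s₀) 2 H) n +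
        complexBetti.map (Motives.fiberι f s₀) (2 * n) W) :
    ∀ s : Motives.ComplexPoints S,
      complexBetti.map (Motives.fiberι f s) (2 * n) W ∈ algebraicClasses (Motives.fiberOver f s) n := by
  intro s
  obtain ⟨m, rfl⟩ : ∃ m, n = m + 1 := ⟨n - 1, by omega⟩
  -- the engine: `q_n H_s^n + W_s` is algebraic on `𝒳_s`
  have halg := engine_of_perry hP (m + 1) f hf hirr hS hSqp H hH W (fun s ↦ (hW s).1) (fun s ↦ (hW s).2) s₀ C
    E₀ hE₀ hsr q hk hchn s
  -- `H_s^n` is algebraic on `𝒳_s`: Lefschetz (1,1) + Kleiman on the abelian chart `A' ≅ 𝒳_s`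
  obtain ⟨A', hA'dim, ⟨e₁⟩⟩ := hchart s
  have hA'sp : Motives.IsSmoothProjective (2 * (m + 1)) A'.X := by
    have h := Motives.AbelianVariety.isSmoothProjective_holds (A := A')
    rw [Motives.AbelianVariety.isSmoothProjective, hA'dim] at h
    exact h
  have hh₁rat : IsRationalClass (complexBetti.map e₁.hom 2 (complexBetti.map (Motives.fiberι f s) 2 H)) :=
    (hH s).1.map _
  have hh₁H : IsOfHodgeType (2 * (m + 1)) A'.X 2 1 1
      (complexBetti.map e₁.hom 2 (complexBetti.map (Motives.fiberι f s) 2 H)) :=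
    (hH s).2.map_of_iso e₁
  have hh₁alg : complexBetti.map e₁.hom 2 (complexBetti.map (Motives.fiberι f s) 2 H) ∈ algebraicClasses A'.X 1 :=
    lefschetzOneOne_rational_holds hA'sp _ hh₁rat hh₁H
  have hh₁n : complexBetti.map e₁.hom (2 * (m + 1))
      (cupPowTwo (complexBetti.map (Motives.fiberι f s) 2 H) (m + 1)) ∈ algebraicClasses A'.X (m + 1) := by
    rw [complexBetti_map_cupPowTwo]
    exact cupPowTwo_mem_algebraicClasses_abelian A' hh₁alg m
  have hHn : cupPowTwo (complexBetti.map (Motives.fiberι f s) 2 H) (m + 1) ∈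
      algebraicClasses (Motives.fiberOver f s) (m + 1) :=
    Theorems.HeckePrymWeilLine.owf_isoTransport _ A' e₁ (m + 1) _ hh₁n
  -- subtract the ballast
  have h := Submodule.sub_mem _ halg (Submodule.smul_mem _ (((q (m + 1) : ℚ) : ℂ)) hHn)
  rwa [add_sub_cancel_left] at h

/-- **LOCAL-R∞var, hence the GLUE input, at a semiregular polarised anchor.** Same hypotheses; conclusion in the
shape consumed by `weilClassesImaginaryQuadratic_of_anchored_of_variational` / the Baire lemma: the anchor fibre
ITSELF is algebraic (take `s = s₀`), so the family is "anchored" in the sense of R∞anc, and R∞var's implication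
`(∃ s₀, algebraic) → ∀ s, algebraic` holds for it trivially because its conclusion does. Recorded to make the DAG
edge explicit: `Perry ∧ [semiregular polarised anchor object on a Weil family through (A, c)] ⟹ c algebraic`.
[cite: Perry2026Semiregularity, Thm. 1.1 (2)] [cite: Markman2025SecantWeil, Thm. 1.5.1 and §9] -/
theorem weilClass_algebraic_of_perry_semiregularAnchoredFamily
    (hP : Perry2026_semiregularFull_remainsAlgebraic) (n : ℕ) (hn : 1 ≤ n)
    {𝒳 S : Motives.SchemeOver ℂ} (f : 𝒳 ⟶ S) (hf : Motives.IsSmoothProjectiveFamily f (2 * n))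
    (hirr : IrreducibleSpace S.left) (hS : AlgebraicGeometry.Smooth S.hom) (hSqp : IsQuasiProjectiveOver S)
    (H : complexBetti 𝒳 2)
    (hH : ∀ s, IsRationalClass (complexBetti.map (Motives.fiberι f s) 2 H) ∧
      IsOfHodgeType (2 * n) (Motives.fiberOver f s) 2 1 1 (complexBetti.map (Motives.fiberι f s) 2 H))
    (W : complexBetti 𝒳 (2 * n))
    (hW : ∀ s, IsRationalClass (complexBetti.map (Motives.fiberι f s) (2 * n) W) ∧
      IsOfHodgeType (2 * n) (Motives.fiberOver f s) (2 * n) n n (complexBetti.map (Motives.fiberι f s) (2 * n) W))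
    (hchart : ∀ s, ∃ A' : Motives.AbelianVariety ℂ, A'.dim = 2 * n ∧ Nonempty (A'.X ≅ Motives.fiberOver f s))
    (s₀ : Motives.ComplexPoints S) (C : ChernCharacterBetti) (E₀ : (Motives.fiberOver f s₀).left.Modules)
    (hE₀ : Motives.IsFiniteLocallyFree E₀) (hsr : IsISemiregular hE₀ Set.univ) (q : ℕ → ℚ)
    (hk : ∀ k : ℕ, k ≠ n →
      C.ch (Motives.fiberOver f s₀) E₀ k = ((q k : ℚ) : ℂ) • cupPowTwo (complexBetti.map (Motives.fiberι f s₀) 2 H) k)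
    (hchn : C.ch (Motives.fiberOver f s₀) E₀ n =
      ((q n : ℚ) : ℂ) • cupPowTwo (complexBetti.map (Motives.fiberι f s₀) 2 H) n +
        complexBetti.map (Motives.fiberι f s₀) (2 * n) W)
    {A : Motives.AbelianVariety ℂ} (s₁ : Motives.ComplexPoints S) (ι : A.X ≅ Motives.fiberOver f s₁)
    {c : complexBetti A.X (2 * n)}
    (hιc : complexBetti.map ι.hom (2 * n) (complexBetti.map (Motives.fiberι f s₁) (2 * n) W) = c) :
    c ∈ algebraicClasses A.X n := by
  rw [← hιc]
  exact Theorems.isoInvariance_proof ι n _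
    (weilVariationalHodgeQuadratic_conclusion_of_perry_semiregularAnchor hP n hn f hf hirr hS hSqp H hH W hW
      hchart s₀ C E₀ hE₀ hsr q hk hchn s₁)

end Summit.HodgeConjecture.HodgeConjecture.WeilTypeLadder

end
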